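import Summits.CriticalPhenomena.PercolationContinuityZ3.Theorems.FK.PressureQDifferentiability
import Summits.CriticalPhenomena.PercolationContinuityZ3.Theorems.FK.BoxLimitSemicontinuityQ
import HarnessLib

/-!
# FK-continuity cell, FO-10a: the one-sided `q`-derivatives of the random-cluster pressure are `κ⁰(p,q)/q` (right) and
# `κ¹(p,q)/q` (left); `Φ(p,·)` is differentiable at `q` iff `φ⁰_{p,q} = φ¹_{p,q}`
# (Grimmett 2006, Lemma (4.79) in full and (4.84), WITHOUT the ergodic theorem)

Registered R92 (cell INBOX l.6438, 2026-08-24); registry row FO-10a-g338q; label KAQ-B (coordinator fk-4 g195).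
Cell `fk-continuity` (bschramm), row FO-10a; support file for the FK-continuity transplant
(`--supports stmt-CriticalPhenomena-4575`); builds on p205010 (kernel theorem, internal audit signed;
external expert review pending). Pure proofs; no definitions, no named facts, no sorries; `d ≥ 1`.

Notation: `κ^b(p,q) = φ^b_{p,q}(|C_0|⁻¹) = ∫ ((openCluster ω 0).ncard)⁻¹ ∂(rcLimit d b p q)`. From the free lower bound
`|Λ_N| κ⁰ − 1 ≤ E⁰_{Λ_N}[k]` (`BoxClusterCountFree.lean`), the wired upper bound `E¹_{Λ_N}[k] ≤ |Λ_N| κ¹ + 2`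
(`BoxClusterCountWired.lean`) and the `q`-tangent inequalities (`PressureClusterDensity.lean`):
`log(y/q)·κ⁰(p,q) ≤ Φ(y) − Φ(q)` for `y ≥ q` and `log(y/q)·κ¹(p,q) ≤ Φ(y) − Φ(q)` for `y ≤ q`, at EVERY `q ≥ 1`. Read at
the two endpoints and combined with `κ¹ ≤ κ⁰` (Prop. (4.85) file) and the one-sided continuity of `q ↦ κ^b(p,q)`
(`BoxLimitSemicontinuityQ.lean`: `φ⁰` right-, `φ¹` left-continuous in `q`, transferred to `|C|⁻¹` by the uniform local
proxies of `ClusterDensityContinuity.lean`), they squeeze the slopes of `Φ`: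

* `tendsto_integral_inv_ncard_rcLimit_of_forall_local_right` + `tendsto_integral_inv_ncard_rcLimit_false_nhdsGT_right`
  (`κ⁰(p,y) → κ⁰(p,q)` as `y ↓ q`), `tendsto_integral_inv_ncard_rcLimit_true_nhdsLT_right` (`κ¹(p,y) → κ¹(p,q)` as `y ↑ q`);
* `log_mul_integral_le_pressure_sub_free` / `_wired` — the two tangent inequalities at any `q₁ ≥ 1`;
* **`hasDerivWithinAt_pressure_q_Ioi`** — `Φ'(q+) = κ⁰(p,q)/q`; **`hasDerivWithinAt_pressure_q_Iio`** — `Φ'(q−) = κ¹(p,q)/q`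
  (Grimmett (4.84), one-sided, at every `q > 1`);
* **`differentiableAt_pressure_q_iff`** — `DifferentiableAt ℝ Φ q ↔ rcLimit d false p q = rcLimit d true p q`
  (Lemma (4.79) in full: `κ ∈ 𝒟″_π` iff non-uniqueness).

## References
* G. Grimmett, *The Random-Cluster Model*, Springer 2006 (`book:grimmett2006-random-cluster-model`): §4.5,
  Lemma (4.79), (4.80)–(4.84), Prop. (4.85), Prop. (4.28) [PDF pp. 79–80, 93–95]. [Grimmett2006]
-/

noncomputable section

open scoped Classical
open Finset Filter Topology MeasureTheory Set

namespace Summit.CriticalPhenomena.PercolationContinuityZ3.Theorems.FK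

open Literature.Probability.Percolation Literature.Probability.LatticeModels

variable {d : ℕ} {p : ℝ}

/-! ### One-sided continuity of `q ↦ κ^b(p,q)` -/

section Transfer

/-- **Transfer of `q`-limits from increasing local events to the cluster density** (the `q`-mirror of
`tendsto_integral_inv_ncard_rcLimit_of_forall_local`): if along a filter `l` of parameters `t ≥ 1` every increasing local
probability `φ^b_{p,t}(A)` tends to `φ^{b'}_{p,q}(A)`, then `∫ |C_x|⁻¹ dφ^b_{p,t} → ∫ |C_x|⁻¹ dφ^{b'}_{p,q}`.
[cite: Grimmett2006, Prop. (4.28) with (4.84)] -/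
theorem tendsto_integral_inv_ncard_rcLimit_of_forall_local_right (hp : p ∈ Set.Icc (0 : ℝ) 1) {q : ℝ} (hq : 1 ≤ q)
    (x : Site d) {b b' : Bool} {l : Filter ℝ} (hl : ∀ᶠ t in l, (1 : ℝ) ≤ t)
    (hloc : ∀ (A : Set (BondConfig (Site d))) (F : Finset (Sym2 (Site d))), IsUpperSet A → DeterminedBy A ↑F →
      Tendsto (fun t : ℝ => (rcLimit d b p t).real A) l (𝓝 ((rcLimit d b' p q).real A))) :
    Tendsto (fun t : ℝ => ∫ ω, ((openCluster ω x).ncard : ℝ)⁻¹ ∂(rcLimit d b p t)) l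
      (𝓝 (∫ ω, ((openCluster ω x).ncard : ℝ)⁻¹ ∂(rcLimit d b' p q))) := by
  set m := siteRad x with hm
  have hxm : x ∈ box d m := mem_box_iff_siteRad_le.2 le_rfl
  set B : ℕ → Set (BondConfig (Site d)) := fun k =>
    {ω | (k : ℕ∞) ≤ (openCluster (ω ∩ ↑(edgesIn (zdGraph d) (box d (m + k)))) x).encard} with hB
  have hBeq : ∀ (c : Bool) {t : ℝ}, 1 ≤ t → ∀ k,
      (rcLimit d c p t).real (clusterSizeGe x k) = (rcLimit d c p t).real (B k) := fun c t ht k =>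
    measureReal_clusterSizeGe_eq_of_ae_subset ((isBoxLimit_rcLimit c hp ht).ae_subset_edgeSet hp (one_pos.trans_le ht))
      hxm k
  refine tendsto_of_forall_eventually_approx fun ε hε => ?_
  obtain ⟨N, hN⟩ := exists_nat_one_div_lt hε
  have hN1 : (1 : ℝ) / ((N + 1 : ℕ) : ℝ) ≤ ε := by push_cast; exact hN.le
  refine ⟨fun t => 1 - ∑ k ∈ Finset.Icc 2 (N + 1), (rcLimit d b p t).real (B k) / (((k : ℝ) - 1) * k),
    1 - ∑ k ∈ Finset.Icc 2 (N + 1), (rcLimit d b' p q).real (B k) / (((k : ℝ) - 1) * k), ?_, ?_, ?_⟩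
  · refine tendsto_const_nhds.sub (tendsto_finsetSum _ fun k _ => ?_)
    exact (hloc _ _ (isUpperSet_le_encard_openCluster_inter x m k) (determinedBy_le_encard_openCluster_inter x m k)).div_const _
  · filter_upwards [hl] with t ht
    haveI := isProbabilityMeasure_rcLimit b p t (d := d)
    have h := abs_integral_inv_ncard_sub_le (rcLimit d b p t) x (N + 1) (by omega)
    simp_rw [hBeq b ht] at h
    exact h.trans hN1
  · haveI := isProbabilityMeasure_rcLimit b' p q (d := d)
    have h := abs_integral_inv_ncard_sub_le (rcLimit d b' p q) x (N + 1) (by omega)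
    simp_rw [hBeq b' hq] at h
    exact h.trans hN1

/-- **`κ⁰(p,y) → κ⁰(p,q)` as `y ↓ q`** (`q ≥ 1`): `φ⁰_{p,·}` is right-continuous in `q` on increasing local events.
[cite: Grimmett2006, Prop. (4.28), in q, with (4.84)] -/
theorem tendsto_integral_inv_ncard_rcLimit_false_nhdsGT_right (hp : p ∈ Set.Icc (0 : ℝ) 1) {q : ℝ} (hq : 1 ≤ q)
    (x : Site d) :
    Tendsto (fun y : ℝ => ∫ ω, ((openCluster ω x).ncard : ℝ)⁻¹ ∂(rcLimit d false p y)) (𝓝[>] q)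
      (𝓝 (∫ ω, ((openCluster ω x).ncard : ℝ)⁻¹ ∂(rcLimit d false p q))) :=
  tendsto_integral_inv_ncard_rcLimit_of_forall_local_right hp hq x
    (by filter_upwards [self_mem_nhdsWithin] with t ht; exact hq.trans (le_of_lt ht))
    fun _ _ hAu hA => tendsto_rcLimit_false_real_nhdsGT_right hp hA hAu hq

/-- **`κ¹(p,y) → κ¹(p,q)` as `y ↑ q`** (`q > 1`, `d ≥ 1`): `φ¹_{p,·}` is left-continuous in `q` on increasing local events.
[cite: Grimmett2006, Prop. (4.28), in q, with (4.84)] -/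
theorem tendsto_integral_inv_ncard_rcLimit_true_nhdsLT_right (hd : 0 < d) (hp : p ∈ Set.Icc (0 : ℝ) 1) {q : ℝ}
    (hq : 1 < q) (x : Site d) :
    Tendsto (fun y : ℝ => ∫ ω, ((openCluster ω x).ncard : ℝ)⁻¹ ∂(rcLimit d true p y)) (𝓝[<] q)
      (𝓝 (∫ ω, ((openCluster ω x).ncard : ℝ)⁻¹ ∂(rcLimit d true p q))) :=
  tendsto_integral_inv_ncard_rcLimit_of_forall_local_right hp hq.le x
    (by filter_upwards [Ioo_mem_nhdsLT hq] with t ht; exact ht.1.le)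
    fun _ _ hAu hA => tendsto_rcLimit_true_real_nhdsLT_right hd hp hA hAu hq

end Transfer

/-! ### The `q`-tangent inequalities at every `q ≥ 1` -/

section Secant

/-- The free per-site mean cluster count at `q` is asymptotically `≥ κ⁰(p,q)` (`d ≥ 1`).
[cite: Grimmett2006, proof of Thm. (4.58), (4.81)–(4.83)] -/
theorem eventually_integral_sub_le_rcExpect_clusterCount_div (hd : 0 < d) (hp : p ∈ Set.Icc (0 : ℝ) 1) {q : ℝ}
    (hq : 1 ≤ q) {δ : ℝ} (hδ : 0 < δ) :
    ∀ᶠ N : ℕ in atTop, ∫ ω, ((openCluster ω (0 : Site d)).ncard : ℝ)⁻¹ ∂(rcLimit d false p q) - δ ≤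
      rcExpect (finsetGraph (zdGraph d) (box d N)) p q (boxBC d false N)
        (fun ω => (clusterCount (↑ω : BondConfig ↥(box d N)) (boxBC d false N) : ℝ)) / #(box d N) := by
  have hcardpos : ∀ N : ℕ, (0 : ℝ) < #(box d N) := fun N => by exact_mod_cast Finset.card_pos.2 (box_nonempty d N)
  filter_upwards [(tendsto_inv_card_box hd).eventually (eventually_le_nhds hδ)] with N hN
  have h := sum_integral_inv_ncard_sub_one_le_rcExpect_clusterCount hp hq N (d := d)
  simp_rw [integral_inv_ncard_openCluster_rcLimit_eq false hp hq] at h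
  rw [Finset.sum_const, Finset.card_univ, Fintype.card_coe, nsmul_eq_mul] at h
  rw [le_div_iff₀ (hcardpos N)]
  have h1 : ((#(box d N) : ℝ))⁻¹ ≤ δ := hN
  rw [inv_le_iff_one_le_mul₀ (hcardpos N)] at h1
  nlinarith [h1, h]

/-- The wired per-site mean cluster count at `q` is asymptotically `≤ κ¹(p,q)` (`d ≥ 1`).
[cite: Grimmett2006, proof of Thm. (4.58), (4.81)–(4.83)] -/
theorem eventually_rcExpect_clusterCount_div_le_integral_add (hd : 0 < d) (hp : p ∈ Set.Icc (0 : ℝ) 1) {q : ℝ}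
    (hq : 1 ≤ q) {δ : ℝ} (hδ : 0 < δ) :
    ∀ᶠ N : ℕ in atTop, rcExpect (finsetGraph (zdGraph d) (box d N)) p q (boxBC d true N)
        (fun ω => (clusterCount (↑ω : BondConfig ↥(box d N)) (boxBC d true N) : ℝ)) / #(box d N) ≤
      ∫ ω, ((openCluster ω (0 : Site d)).ncard : ℝ)⁻¹ ∂(rcLimit d true p q) + δ := by
  have hcardpos : ∀ N : ℕ, (0 : ℝ) < #(box d N) := fun N => by exact_mod_cast Finset.card_pos.2 (box_nonempty d N)
  filter_upwards [(tendsto_inv_card_box hd).eventually (eventually_le_nhds (half_pos hδ))] with N hN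
  have h := rcExpect_clusterCount_true_le_sum_integral_inv_ncard_add_two hd hp hq N
  simp_rw [integral_inv_ncard_openCluster_rcLimit_eq true hp hq] at h
  rw [Finset.sum_const, Finset.card_univ, Fintype.card_coe, nsmul_eq_mul] at h
  rw [div_le_iff₀ (hcardpos N)]
  have h1 : ((#(box d N) : ℝ))⁻¹ ≤ δ / 2 := hN
  rw [inv_le_iff_one_le_mul₀ (hcardpos N)] at h1
  nlinarith [h1, h]

/-- **Free tangent inequality at `q₁ ≤ q₂`: `log(q₂/q₁)·κ⁰(p,q₁) ≤ Φ₂ − Φ₁`.** [cite: Grimmett2006, (4.80)–(4.82)] -/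
theorem log_mul_integral_le_pressure_sub_free (hd : 0 < d) (hp : p ∈ Set.Ioo (0 : ℝ) 1) {q₁ q₂ : ℝ} (hq₁ : 1 ≤ q₁)
    (h12 : q₁ ≤ q₂) {Φ₁ Φ₂ : ℝ}
    (hΦ₁ : Tendsto (fun N : ℕ =>
      Real.log (rcPartitionFunction (finsetGraph (zdGraph d) (box d N)) p q₁ (boxBC d false N)) / #(box d N)) atTop (𝓝 Φ₁))
    (hΦ₂ : Tendsto (fun N : ℕ =>
      Real.log (rcPartitionFunction (finsetGraph (zdGraph d) (box d N)) p q₂ (boxBC d false N)) / #(box d N)) atTop (𝓝 Φ₂)) :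
    Real.log (q₂ / q₁) * ∫ ω, ((openCluster ω (0 : Site d)).ncard : ℝ)⁻¹ ∂(rcLimit d false p q₁) ≤ Φ₂ - Φ₁ :=
  log_mul_le_pressure_sub_of_le hp (one_pos.trans_le hq₁) h12 hΦ₁ hΦ₂ fun _ hδ =>
    eventually_integral_sub_le_rcExpect_clusterCount_div hd ⟨hp.1.le, hp.2.le⟩ hq₁ hδ

/-- **Wired tangent inequality at `q₂ ≤ q₁`: `log(q₂/q₁)·κ¹(p,q₁) ≤ Φ₂ − Φ₁`** (`1 ≤ q₂`). [cite: Grimmett2006, (4.80)–(4.82)] -/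
theorem log_mul_integral_le_pressure_sub_wired (hd : 0 < d) (hp : p ∈ Set.Ioo (0 : ℝ) 1) {q₁ q₂ : ℝ} (hq₂ : 1 ≤ q₂)
    (h21 : q₂ ≤ q₁) {Φ₁ Φ₂ : ℝ}
    (hΦ₁ : Tendsto (fun N : ℕ =>
      Real.log (rcPartitionFunction (finsetGraph (zdGraph d) (box d N)) p q₁ (boxBC d true N)) / #(box d N)) atTop (𝓝 Φ₁))
    (hΦ₂ : Tendsto (fun N : ℕ =>
      Real.log (rcPartitionFunction (finsetGraph (zdGraph d) (box d N)) p q₂ (boxBC d true N)) / #(box d N)) atTop (𝓝 Φ₂)) :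
    Real.log (q₂ / q₁) * ∫ ω, ((openCluster ω (0 : Site d)).ncard : ℝ)⁻¹ ∂(rcLimit d true p q₁) ≤ Φ₂ - Φ₁ :=
  log_mul_le_pressure_sub_of_ge hp (one_pos.trans_le hq₂) h21 hΦ₁ hΦ₂ fun _ hδ =>
    eventually_rcExpect_clusterCount_div_le_integral_add hd ⟨hp.1.le, hp.2.le⟩ (hq₂.trans h21) hδ

end Secant

/-! ### The one-sided `q`-derivatives of the pressure: (4.84) -/

section Derivatives

variable {Φ : ℝ → ℝ}

/-- **`Φ'(q+) = κ⁰(p,q)/q`**: the right `q`-derivative of the pressure is the FREE cluster density over `q`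
(`d ≥ 1`, `0 < p < 1`, `q ≥ 1`). Lower bound: the free tangent inequality at `q`; upper bound: the wired tangent inequality
read from `y ↓ q`, `κ¹(p,y) ≤ κ⁰(p,y)` and `κ⁰(p,y) → κ⁰(p,q)`. [cite: Grimmett2006, (4.84) and proof of Lemma (4.79)] -/
theorem hasDerivWithinAt_pressure_q_Ioi (hd : 0 < d) (hp : p ∈ Set.Ioo (0 : ℝ) 1) {q : ℝ} (hq : 1 ≤ q)
    (hΦ : ∀ b : Bool, ∀ᶠ y in 𝓝 q, Tendsto (fun N : ℕ =>
      Real.log (rcPartitionFunction (finsetGraph (zdGraph d) (box d N)) p y (boxBC d b N)) / #(box d N)) atTop (𝓝 (Φ y))) :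
    HasDerivWithinAt Φ ((∫ ω, ((openCluster ω (0 : Site d)).ncard : ℝ)⁻¹ ∂(rcLimit d false p q)) / q) (Set.Ioi q) q := by
  have hp' : p ∈ Set.Icc (0 : ℝ) 1 := ⟨hp.1.le, hp.2.le⟩
  have hq0 : 0 < q := one_pos.trans_le hq
  set κ : ℝ → ℝ := fun y => ∫ ω, ((openCluster ω (0 : Site d)).ncard : ℝ)⁻¹ ∂(rcLimit d false p y) with hκ
  have hlog : Tendsto (slope Real.log q) (𝓝[>] q) (𝓝 q⁻¹) :=
    (hasDerivAt_iff_tendsto_slope.1 (Real.hasDerivAt_log hq0.ne')).mono_left (nhdsGT_le_nhdsNE q)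
  have hlogslope : ∀ {y : ℝ}, 0 < y → y ≠ q → Real.log (y / q) = slope Real.log q y * (y - q) := by
    intro y hy hyq
    rw [slope_def_field, Real.log_div hy.ne' hq0.ne', div_mul_cancel₀ _ (sub_ne_zero.2 hyq)]
  rw [hasDerivWithinAt_iff_tendsto_slope' (show q ∉ Set.Ioi q from lt_irrefl q), div_eq_mul_inv]
  have hlow : Tendsto (fun y => κ q * slope Real.log q y) (𝓝[>] q) (𝓝 (κ q * q⁻¹)) := hlog.const_mul _
  have hup : Tendsto (fun y => κ y * slope Real.log q y) (𝓝[>] q) (𝓝 (κ q * q⁻¹)) :=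
    (tendsto_integral_inv_ncard_rcLimit_false_nhdsGT_right hp' hq 0).mul hlog
  have hq0' := (hΦ false).self_of_nhds
  have hq1' := (hΦ true).self_of_nhds
  refine tendsto_of_tendsto_of_tendsto_of_le_of_le' hlow hup ?_ ?_
  · filter_upwards [nhdsWithin_le_nhds (hΦ false), eventually_mem_nhdsWithin] with y hy hyq
    have hyq' : q < y := hyq
    have h := log_mul_integral_le_pressure_sub_free hd hp hq hyq'.le hq0' hy
    rw [hlogslope (hq0.trans hyq') hyq'.ne'] at h
    rw [slope_def_field Φ q y, le_div_iff₀ (sub_pos.2 hyq')]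
    linarith
  · filter_upwards [nhdsWithin_le_nhds (hΦ true), eventually_mem_nhdsWithin] with y hy hyq
    have hyq' : q < y := hyq
    have hy1 : 1 ≤ y := hq.trans hyq'.le
    -- wired tangent inequality at `(y, q)`: `log(q/y) κ¹(y) ≤ Φ q − Φ y`
    have h := log_mul_integral_le_pressure_sub_wired hd hp hq hyq'.le hy hq1'
    have hκ10 : ∫ ω, ((openCluster ω (0 : Site d)).ncard : ℝ)⁻¹ ∂(rcLimit d true p y) ≤ κ y :=
      integral_inv_ncard_openCluster_true_le_false hp' hy1 0
    have hlogpos : 0 ≤ Real.log (y / q) := Real.log_nonneg ((one_le_div hq0).2 hyq'.le)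
    have e : Real.log (q / y) = -Real.log (y / q) := by rw [← Real.log_inv, inv_div]
    rw [e] at h
    have h2 : Φ y - Φ q ≤ Real.log (y / q) * κ y := by nlinarith [mul_le_mul_of_nonneg_left hκ10 hlogpos]
    rw [hlogslope (hq0.trans hyq') hyq'.ne'] at h2
    rw [slope_def_field Φ q y, div_le_iff₀ (sub_pos.2 hyq')]
    linarith

/-- **`Φ'(q−) = κ¹(p,q)/q`**: the left `q`-derivative of the pressure is the WIRED cluster density over `q`
(`d ≥ 1`, `0 < p < 1`, `q > 1`). Upper bound: the wired tangent inequality at `q`; lower bound: the free tangent inequality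
read from `y ↑ q`, `κ¹(p,y) ≤ κ⁰(p,y)` and `κ¹(p,y) → κ¹(p,q)`. [cite: Grimmett2006, (4.84) and proof of Lemma (4.79)] -/
theorem hasDerivWithinAt_pressure_q_Iio (hd : 0 < d) (hp : p ∈ Set.Ioo (0 : ℝ) 1) {q : ℝ} (hq : 1 < q)
    (hΦ : ∀ b : Bool, ∀ᶠ y in 𝓝 q, Tendsto (fun N : ℕ =>
      Real.log (rcPartitionFunction (finsetGraph (zdGraph d) (box d N)) p y (boxBC d b N)) / #(box d N)) atTop (𝓝 (Φ y))) :
    HasDerivWithinAt Φ ((∫ ω, ((openCluster ω (0 : Site d)).ncard : ℝ)⁻¹ ∂(rcLimit d true p q)) / q) (Set.Iio q) q := by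
  have hp' : p ∈ Set.Icc (0 : ℝ) 1 := ⟨hp.1.le, hp.2.le⟩
  have hq0 : 0 < q := one_pos.trans hq
  set κ : ℝ → ℝ := fun y => ∫ ω, ((openCluster ω (0 : Site d)).ncard : ℝ)⁻¹ ∂(rcLimit d true p y) with hκ
  have hlog : Tendsto (slope Real.log q) (𝓝[<] q) (𝓝 q⁻¹) :=
    (hasDerivAt_iff_tendsto_slope.1 (Real.hasDerivAt_log hq0.ne')).mono_left (nhdsLT_le_nhdsNE q)
  have hlogslope : ∀ {y : ℝ}, 0 < y → y ≠ q → Real.log (y / q) = slope Real.log q y * (y - q) := by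
    intro y hy hyq
    rw [slope_def_field, Real.log_div hy.ne' hq0.ne', div_mul_cancel₀ _ (sub_ne_zero.2 hyq)]
  rw [hasDerivWithinAt_iff_tendsto_slope' (show q ∉ Set.Iio q from lt_irrefl q), div_eq_mul_inv]
  have hup : Tendsto (fun y => κ q * slope Real.log q y) (𝓝[<] q) (𝓝 (κ q * q⁻¹)) := hlog.const_mul _
  have hlow : Tendsto (fun y => κ y * slope Real.log q y) (𝓝[<] q) (𝓝 (κ q * q⁻¹)) :=
    (tendsto_integral_inv_ncard_rcLimit_true_nhdsLT_right hd hp' hq 0).mul hlog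
  have hq0' := (hΦ false).self_of_nhds
  have hq1' := (hΦ true).self_of_nhds
  have h1mem : ∀ᶠ y in 𝓝[<] q, (1 : ℝ) ≤ y := by
    filter_upwards [Ioo_mem_nhdsLT hq] with y hy using hy.1.le
  refine tendsto_of_tendsto_of_tendsto_of_le_of_le' hlow hup ?_ ?_
  · filter_upwards [nhdsWithin_le_nhds (hΦ false), eventually_mem_nhdsWithin, h1mem] with y hy hyq hy1
    have hyq' : y < q := hyq
    have hy0 : 0 < y := one_pos.trans_le hy1
    -- free tangent inequality at `(y, q)`: `log(q/y) κ⁰(y) ≤ Φ q − Φ y`, and `κ¹(y) ≤ κ⁰(y)`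
    have h := log_mul_integral_le_pressure_sub_free hd hp hy1 hyq'.le hy hq0'
    have hκ10 : κ y ≤ ∫ ω, ((openCluster ω (0 : Site d)).ncard : ℝ)⁻¹ ∂(rcLimit d false p y) :=
      integral_inv_ncard_openCluster_true_le_false hp' hy1 0
    have hlogpos : 0 ≤ Real.log (q / y) := Real.log_nonneg ((one_le_div hy0).2 hyq'.le)
    have h2 : Real.log (q / y) * κ y ≤ Φ q - Φ y := (mul_le_mul_of_nonneg_left hκ10 hlogpos).trans h
    have e : Real.log (q / y) = -Real.log (y / q) := by rw [← Real.log_inv, inv_div]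
    rw [e, hlogslope hy0 hyq'.ne] at h2
    rw [slope_def_field Φ q y, le_div_iff_of_neg (sub_neg.2 hyq')]
    linarith
  · filter_upwards [nhdsWithin_le_nhds (hΦ true), eventually_mem_nhdsWithin, h1mem] with y hy hyq hy1
    have hyq' : y < q := hyq
    have hy0 : 0 < y := one_pos.trans_le hy1
    have h := log_mul_integral_le_pressure_sub_wired hd hp hy1 hyq'.le hq1' hy
    rw [hlogslope hy0 hyq'.ne] at h
    rw [slope_def_field Φ q y, div_le_iff_of_neg (sub_neg.2 hyq')]
    linarith

/-- **Grimmett 2006, Lemma (4.79) in full: `Φ(p,·)` is differentiable at `q` iff `φ⁰_{p,q} = φ¹_{p,q}`**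
(`d ≥ 1`, `0 < p < 1`, `q > 1`; the jump of the derivative is `(κ⁰ − κ¹)/q`).
[cite: Grimmett2006, Lemma (4.79), (4.84), Prop. (4.85)] -/
theorem differentiableAt_pressure_q_iff (hd : 0 < d) (hp : p ∈ Set.Ioo (0 : ℝ) 1) {q : ℝ} (hq : 1 < q)
    (hΦ : ∀ b : Bool, ∀ᶠ y in 𝓝 q, Tendsto (fun N : ℕ =>
      Real.log (rcPartitionFunction (finsetGraph (zdGraph d) (box d N)) p y (boxBC d b N)) / #(box d N)) atTop (𝓝 (Φ y))) :
    DifferentiableAt ℝ Φ q ↔ rcLimit d false p q = rcLimit d true p q := by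
  refine ⟨rcLimit_false_eq_rcLimit_true_of_differentiableAt_pressure_q hd hp hq.le hΦ, fun heq => ?_⟩
  have hR := hasDerivWithinAt_pressure_q_Ioi hd hp hq.le hΦ
  have hL := hasDerivWithinAt_pressure_q_Iio hd hp hq hΦ
  rw [heq] at hR
  have h := (hL.Iic_of_Iio).union (hR.Ici_of_Ioi)
  rw [Set.Iic_union_Ici, hasDerivWithinAt_univ] at h
  exact h.differentiableAt

end Derivatives

end Summit.CriticalPhenomena.PercolationContinuityZ3.Theorems.FK

end
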